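import Summits.AtomisticToContinuum.HydrodynamicLimit.Theorems.CollisionIsometryCLTDiffuseBackwardInfluenceDefs
import Summits.AtomisticToContinuum.HydrodynamicLimit.Theorems.DiffuseBackwardInfluence.Negative.RowBudget

/-!
# `DiffuseBackwardInfluence`, line `share-nondegeneracy-one-flight`, stub `stub_onePathBound` (1/5): the exchange rule

Support file (`--supports stmt-AtomisticToContinuum-12950`) of the PATHWISE one-path bound. The whole physics of the
tracer duality is the EXCHANGE RULE of one fold step (`blockMass_succ_fst/snd`, registered sub-goal
`onePath_blockMass_succ_fst`): if step `n` reflects the pair `(p, q)` with realised unit normal `ω`, then for every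
source `k` the block masses move as `a'_{pk} = a_{pk} − x_p + x_q`, `a'_{qk} = a_{qk} − x_q + x_p` with the shares
`x_i = blockShare n i k ω ∈ [0, a_{ik}]`, all other rows being untouched. Also here: the slot grid is monotone when
the window carries a fold step (`slotStart_mono`), and the restart time of the last `2m` of `2mL` slots is the first
index of `lateMergeFr` (`slotStart_restart`).
-/

namespace Summit.AtomisticToContinuum.HydrodynamicLimit.Theorems.DiffuseBackwardInfluenceShare

open scoped BigOperators Topology ENNReal InnerProductSpace Classical
open Filter Set MeasureTheory
open Literature.Analysis.FluidPDE
open Literature.MathematicalPhysics.KineticTheory (localGibbsLaw hsDiameter)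
open Summit.AtomisticToContinuum.HydrodynamicLimit.Theorems.DiffuseBackwardInfluenceNeg

noncomputable section

namespace OnePath

variable {σ : ℝ} {N : ℕ}

/-! ## §1 The exchange rule of one fold step -/

/-- The reflection coefficient in terms of the unit normal:
`(⟪u − v, n⟫ / ‖n‖²) • n = ⟪u − v, ω⟫ • ω` with `ω = ‖n‖⁻¹ • n` (both sides vanish at `n = 0`). [folklore] -/
theorem div_norm_sq_smul_eq (nrm w : V3) :
    (⟪w, nrm⟫_ℝ / ‖nrm‖ ^ 2) • nrm = ⟪w, ‖nrm‖⁻¹ • nrm⟫_ℝ • (‖nrm‖⁻¹ • nrm) := by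
  rw [real_inner_smul_right, smul_smul]
  congr 1
  rw [div_eq_mul_inv, sq, mul_inv]
  ring

/-- The realised unit normal is a unit vector or zero. [folklore] -/
theorem norm_unitNormal_eq_one_or (y : Cfg N) (n : ℕ) :
    ‖unitNormal σ N y n‖ = 1 ∨ unitNormal σ N y n = 0 := by
  unfold unitNormal
  by_cases h0 : normalAt σ N y n = 0
  · right; rw [h0, smul_zero]
  · left; exact norm_smul_inv_norm h0

/-- `‖u − ⟪u − v, ω⟫ω‖² = ‖u‖² − ⟪ω,u⟫² + ⟪ω,v⟫²` for a unit vector or zero `ω`. [folklore] -/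
theorem norm_sq_sub_proj (u v ω : V3) (hω : ‖ω‖ = 1 ∨ ω = 0) :
    ‖u - ⟪u - v, ω⟫_ℝ • ω‖ ^ 2 = ‖u‖ ^ 2 - ⟪ω, u⟫_ℝ ^ 2 + ⟪ω, v⟫_ℝ ^ 2 := by
  rcases hω with h1 | h0
  · rw [norm_sub_sq_real, real_inner_smul_right, norm_smul, Real.norm_eq_abs, h1, mul_one, sq_abs,
      inner_sub_left, real_inner_comm ω u, real_inner_comm ω v]
    ring
  · simp [h0]

/-- `‖v + ⟪u − v, ω⟫ω‖² = ‖v‖² − ⟪ω,v⟫² + ⟪ω,u⟫²` for a unit vector or zero `ω`. [folklore] -/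
theorem norm_sq_add_proj (u v ω : V3) (hω : ‖ω‖ = 1 ∨ ω = 0) :
    ‖v + ⟪u - v, ω⟫_ℝ • ω‖ ^ 2 = ‖v‖ ^ 2 - ⟪ω, v⟫_ℝ ^ 2 + ⟪ω, u⟫_ℝ ^ 2 := by
  rcases hω with h1 | h0
  · rw [norm_add_sq_real, real_inner_smul_right, norm_smul, Real.norm_eq_abs, h1, mul_one, sq_abs,
      inner_sub_left, real_inner_comm ω u, real_inner_comm ω v]
    ring
  · simp [h0]

/-- One more step of a block column: `blockCol (n+1) = step n` applied to the columns at `n`. [folklore] -/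
theorem blockCol_succ (y : Cfg N) (n : ℕ) (i k : Fin (N + 1)) (a : Fin 3) :
    blockCol σ N y (n + 1) i k a = step σ N y (fun j => blockCol σ N y n j k a) n i := by
  unfold blockCol
  rw [transferN_succ]

/-- EXCHANGE RULE for block columns at the first endpoint: `u' = u − ⟪u − v, ω⟫ω`. [folklore] -/
theorem blockCol_succ_fst {y : Cfg N} {n : ℕ} (h : (pairsAt σ N y n).Nonempty) (k : Fin (N + 1)) (a : Fin 3) :
    blockCol σ N y (n + 1) h.some.1 k a =
      blockCol σ N y n h.some.1 k a -
        ⟪blockCol σ N y n h.some.1 k a - blockCol σ N y n h.some.2 k a, unitNormal σ N y n⟫_ℝ •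
          unitNormal σ N y n := by
  rw [blockCol_succ, step_apply_some_fst h]
  simp only [reflectVel]
  rw [div_norm_sq_smul_eq]
  rfl

/-- EXCHANGE RULE for block columns at the second endpoint: `v' = v + ⟪u − v, ω⟫ω`. [folklore] -/
theorem blockCol_succ_snd {y : Cfg N} {n : ℕ} (h : (pairsAt σ N y n).Nonempty) (k : Fin (N + 1)) (a : Fin 3) :
    blockCol σ N y (n + 1) h.some.2 k a =
      blockCol σ N y n h.some.2 k a +
        ⟪blockCol σ N y n h.some.1 k a - blockCol σ N y n h.some.2 k a, unitNormal σ N y n⟫_ℝ •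
          unitNormal σ N y n := by
  rw [blockCol_succ, step_apply_some_snd h]
  simp only [reflectVel]
  rw [div_norm_sq_smul_eq]
  rfl

/-- Block columns of particles outside the reflected pair do not move. [folklore] -/
theorem blockCol_succ_of_ne {y : Cfg N} {n : ℕ} {i : Fin (N + 1)}
    (hi : ∀ h : (pairsAt σ N y n).Nonempty, i ≠ h.some.1 ∧ i ≠ h.some.2) (k : Fin (N + 1)) (a : Fin 3) :
    blockCol σ N y (n + 1) i k a = blockCol σ N y n i k a := by
  rw [blockCol_succ, step_apply_of_ne hi]

/-- EXCHANGE RULE for block masses at the first endpoint: `a'_p = a_p − x_p + x_q`. [folklore] -/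
theorem blockMass_succ_fst {y : Cfg N} {n : ℕ} (h : (pairsAt σ N y n).Nonempty) (k : Fin (N + 1)) :
    blockMass σ N y (n + 1) h.some.1 k =
      blockMass σ N y n h.some.1 k - blockShare σ N y n h.some.1 k (unitNormal σ N y n) +
        blockShare σ N y n h.some.2 k (unitNormal σ N y n) := by
  unfold blockMass blockShare
  rw [← Finset.sum_sub_distrib, ← Finset.sum_add_distrib]
  refine Finset.sum_congr rfl fun a _ => ?_
  rw [blockCol_succ_fst h, norm_sq_sub_proj _ _ _ (norm_unitNormal_eq_one_or y n)]

/-- EXCHANGE RULE for block masses at the second endpoint: `a'_q = a_q − x_q + x_p`. [folklore] -/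
theorem blockMass_succ_snd {y : Cfg N} {n : ℕ} (h : (pairsAt σ N y n).Nonempty) (k : Fin (N + 1)) :
    blockMass σ N y (n + 1) h.some.2 k =
      blockMass σ N y n h.some.2 k - blockShare σ N y n h.some.2 k (unitNormal σ N y n) +
        blockShare σ N y n h.some.1 k (unitNormal σ N y n) := by
  unfold blockMass blockShare
  rw [← Finset.sum_sub_distrib, ← Finset.sum_add_distrib]
  refine Finset.sum_congr rfl fun a _ => ?_
  rw [blockCol_succ_snd h, norm_sq_add_proj _ _ _ (norm_unitNormal_eq_one_or y n)]

/-- Block masses of particles outside the reflected pair do not move. [folklore] -/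
theorem blockMass_succ_of_ne {y : Cfg N} {n : ℕ} {i : Fin (N + 1)}
    (hi : ∀ h : (pairsAt σ N y n).Nonempty, i ≠ h.some.1 ∧ i ≠ h.some.2) (k : Fin (N + 1)) :
    blockMass σ N y (n + 1) i k = blockMass σ N y n i k := by
  unfold blockMass
  simp_rw [blockCol_succ_of_ne hi]

/-- Bessel / Cauchy–Schwarz: the share along the realised unit normal of the step (a unit vector or zero) is at
most the mass. [folklore] -/
theorem blockShare_unitNormal_le (y : Cfg N) (n : ℕ) (i k : Fin (N + 1)) :
    blockShare σ N y n i k (unitNormal σ N y n) ≤ blockMass σ N y n i k := by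
  have hω : ‖unitNormal σ N y n‖ ≤ 1 := by
    rcases norm_unitNormal_eq_one_or (σ := σ) y n with h | h
    · exact h.le
    · rw [h, norm_zero]; exact zero_le_one
  unfold blockShare blockMass
  refine Finset.sum_le_sum fun a _ => ?_
  have h1 : |⟪unitNormal σ N y n, blockCol σ N y n i k a⟫_ℝ| ≤ ‖blockCol σ N y n i k a‖ :=
    (abs_real_inner_le_norm _ _).trans (mul_le_of_le_one_left (norm_nonneg _) hω)
  rw [← sq_abs]
  exact pow_le_pow_left₀ (abs_nonneg _) h1 2

/-- `shareFrac · mass = share` (also for a massless block, whose share vanishes). [folklore] -/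
theorem shareFrac_mul_blockMass (y : Cfg N) (n : ℕ) (i k : Fin (N + 1)) :
    shareFrac σ N y n i k (unitNormal σ N y n) * blockMass σ N y n i k =
      blockShare σ N y n i k (unitNormal σ N y n) := by
  unfold shareFrac
  by_cases h0 : blockMass σ N y n i k = 0
  · have hle := blockShare_unitNormal_le (σ := σ) y n i k
    have hge := blockShare_nonneg σ N y n i k (unitNormal σ N y n)
    rw [h0, mul_zero]
    linarith
  · exact div_mul_cancel₀ _ h0

/-- `0 ≤ shareFrac` along the realised unit normal of the step. [folklore] -/
theorem shareFrac_unitNormal_nonneg (y : Cfg N) (n : ℕ) (i k : Fin (N + 1)) :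
    0 ≤ shareFrac σ N y n i k (unitNormal σ N y n) :=
  div_nonneg (blockShare_nonneg σ N y n i k _) (blockMass_nonneg σ N y n i k)

/-- `shareFrac ≤ 1` along the realised unit normal of the step. [folklore] -/
theorem shareFrac_unitNormal_le_one (y : Cfg N) (n : ℕ) (i k : Fin (N + 1)) :
    shareFrac σ N y n i k (unitNormal σ N y n) ≤ 1 :=
  div_le_one_of_le₀ (blockShare_unitNormal_le y n i k) (blockMass_nonneg σ N y n i k)

/-! ## §3 The slot grid -/

section Slots

variable {σ : ℝ} {N : ℕ}

/-- If the window `[0, Δ]` carries at least one fold step, the collision counter is monotone in time up to `Δ`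
(the set of counted indices is then bounded; in the junk case of accumulating instants `colls Δ = 0`). [folklore] -/
theorem colls_mono {y : Cfg N} {Δ : ℝ} (hpos : 0 < colls σ N y Δ) {t t' : ℝ} (htt' : t ≤ t') (ht' : t' ≤ Δ) :
    colls σ N y t ≤ colls σ N y t' := by
  unfold colls Alexander.collisionCount at *
  have hB : BddAbove {k : ℕ | Alexander.collisionInstant (Torus.geometry (Fin 3)) (hsDiameter σ N) y k ≤
      ENNReal.ofReal Δ} := by
    by_contra hnb
    rw [Nat.sSup_of_not_bddAbove hnb] at hpos
    exact lt_irrefl 0 hpos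
  refine csSup_le_csSup (hB.mono fun k hk => ?_) ⟨0, ?_⟩ fun k hk => ?_
  · exact le_trans hk (ENNReal.ofReal_le_ofReal ht')
  · simp
  · exact le_trans hk (ENNReal.ofReal_le_ofReal htt')

/-- Slot starts are monotone in the slot index up to `S` (window with at least one fold step). [folklore] -/
theorem slotStart_mono {y : Cfg N} {Δ : ℝ} (hΔ : 0 < Δ) (hpos : 0 < colls σ N y Δ) {S r r' : ℕ} (hS : 0 < S)
    (hrr' : r ≤ r') (hr' : r' ≤ S) : slotStart σ N y Δ S r ≤ slotStart σ N y Δ S r' := by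
  unfold slotStart
  have hS' : (0 : ℝ) < (S : ℝ) := by exact_mod_cast hS
  refine colls_mono hpos ?_ ?_
  · exact div_le_div_of_nonneg_right (mul_le_mul_of_nonneg_right (by exact_mod_cast hrr') hΔ.le) hS'.le
  · rw [div_le_iff₀ hS', mul_comm]
    exact mul_le_mul_of_nonneg_left (by exact_mod_cast hr') hΔ.le

/-- The last slot ends at the last fold step: `slotStart S = colls Δ`. [folklore] -/
theorem slotStart_self {y : Cfg N} {Δ : ℝ} {S : ℕ} (hS : 0 < S) : slotStart σ N y Δ S S = colls σ N y Δ := by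
  unfold slotStart
  have hS' : (S : ℝ) ≠ 0 := by exact_mod_cast hS.ne'
  congr 1
  field_simp

/-- The restart time: the last `2m` of the `2mL` slots start at `colls ((1 − 1/L) Δ)`, the first index of
`lateMergeFr`. [folklore] -/
theorem slotStart_restart {y : Cfg N} {Δ : ℝ} {m L : ℕ} (hm : 1 ≤ m) (hL : 1 ≤ L) :
    slotStart σ N y Δ (2 * m * L) (2 * m * L - 2 * m) = colls σ N y ((1 - 1 / (L : ℝ)) * Δ) := by
  unfold slotStart
  congr 1
  have hm' : (m : ℝ) ≠ 0 := by exact_mod_cast (Nat.one_le_iff_ne_zero.1 hm)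
  have hL' : (L : ℝ) ≠ 0 := by exact_mod_cast (Nat.one_le_iff_ne_zero.1 hL)
  have hle : 2 * m ≤ 2 * m * L := Nat.le_mul_of_pos_right _ hL
  push_cast [Nat.cast_sub hle]
  field_simp

/-- Two slots (with indices `< S`) sharing a step coincide (window with at least one fold step). [folklore] -/
theorem slot_unique {y : Cfg N} {Δ : ℝ} (hΔ : 0 < Δ) (hpos : 0 < colls σ N y Δ) {S r r' c : ℕ} (hr : r < S)
    (hr' : r' < S) (h1 : slotStart σ N y Δ S r ≤ c) (h2 : c < slotStart σ N y Δ S (r + 1))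
    (h1' : slotStart σ N y Δ S r' ≤ c) (h2' : c < slotStart σ N y Δ S (r' + 1)) : r = r' := by
  have hS : 0 < S := lt_of_le_of_lt (Nat.zero_le r) hr
  by_contra hne
  rcases lt_or_gt_of_ne hne with hlt | hlt
  · have := slotStart_mono hΔ hpos hS (Nat.lt_iff_add_one_le.1 hlt) hr'.le
    omega
  · have := slotStart_mono hΔ hpos hS (Nat.lt_iff_add_one_le.1 hlt) hr.le
    omega

/-- `IdleOn ↔ ¬ HasCollIn`. [folklore] -/
theorem idleOn_iff_not_hasCollIn (y : Cfg N) (Δ : ℝ) (S r : ℕ) (i : Fin (N + 1)) :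
    IdleOn σ N y Δ S r i ↔ ¬ HasCollIn σ N y Δ S r i := by
  unfold IdleOn HasCollIn
  constructor
  · rintro h ⟨k, hk1, hk2, hk3⟩
    exact h k hk1 hk2 hk3
  · intro h k hk1 hk2 hk3
    exact h ⟨k, hk1, hk2, hk3⟩

end Slots

end OnePath

/-- EXCHANGE RULE (registered sub-goal, `∀`-form of `OnePath.blockMass_succ_fst`): at the first endpoint of the
reflected pair the block mass of every source moves by `− x_p + x_q`. [folklore] -/
theorem onePath_blockMass_succ_fst : ∀ (σ : ℝ) (N : ℕ) (y : Cfg N) (n : ℕ) (h : (pairsAt σ N y n).Nonempty) (k : Fin (N + 1)), blockMass σ N y (n + 1) h.some.1 k = blockMass σ N y n h.some.1 k - blockShare σ N y n h.some.1 k (unitNormal σ N y n) + blockShare σ N y n h.some.2 k (unitNormal σ N y n) :=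
  fun _ _ _ _ h k => OnePath.blockMass_succ_fst h k

end

end Summit.AtomisticToContinuum.HydrodynamicLimit.Theorems.DiffuseBackwardInfluenceShare
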